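import Summits.BirchSwinnertonDyer.BirchSwinnertonDyer.Theorems.EisensteinPrimesBSDpOnCellCStubC2OfContinuousDisplay
import Summits.BirchSwinnertonDyer.Rank1Residual.X2.CellCBDPValueLZZRoad
import HarnessLib

/-!
# Crux 4 `BSDpOnCellC` (stmt-BirchSwinnertonDyer-19034), line b1 v9: `stub_c2`, the crux at the PRE tier and the ψ-even
# door FROM THE TYPED LZZ INPUT `X2.LZZRoadInput` by name (cell `bsd-eis`, seat `bsd-eis-cgshw` g14; RULING L43 (2)
# «COMMISSION (O2)-LZZ@3», kernel side, part 3 of 3 — the by-name census reading)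

HONEST FRAMING (cell `bsd-eis`, run/shared/lean/pub/bsd-eis/): theorems only (composition); nothing booked; X2 stays
CONSTRUCTION-SHAPED; no label or count moves; BSD is not proved by any of this. Every theorem is CONDITIONAL on its displayed
binders: `X2.LZZRoadInput` (a TYPED INPUT = Liu–Zhang–Zhang 2018 Thm. 3.8 ∧ 3.10 ∧ Prop. 4.12 on the modular curve at `p ‖ N`
rendered in tree currency with flagged readings — NOT a Literature fact, NOT claimed printed in this currency; the typist's filing
of COMMISSION (O2)-LZZ@3 is to imply it), the 16 published named facts + [cas-split] (= v9 `stub_publishedFacts` VERBATIM),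
Keller–Yin Thm. D BY NAME (PREPRINT, gapped at L1754), and — for the whole cell only — crux 3 `MazurMCOnCellB`.

* `stub_c2_of_lzzRoadInput` : `X2.LZZRoadInput →` v9's `stub_c2` VERBATIM (`X2.bdpValueContinuousDisplayAt_of_lzzRoadInput`
  at `p = 3`, then `stub_c2_of_continuousDisplay_three`).
* `bsdpOnCellC_of_lzzRoadInput_of_thmD_OPEN` : PUB(16)+[cas-split] + `LZZRoadInput` + Thm D by name + crux 3 ⊢ `BSDpOnCellC`
  (route decl BY NAME).
* **`bsdpOnCellCNotGV_of_lzzRoadInput_of_thmD_OPEN`** : PUB(16)+[cas-split] + `LZZRoadInput` + Thm D by name ⊢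
  `∀ W p, CellC W p → ¬GVPar W p → BSDp W p` — NO crux 3, NO value atom. Census reading (no label moves here): on ALL ψ-even
  B11 entries (9 981 @3 + 409 @5/@7, class-wide) crux 4's residue is {Keller–Yin Thm. D [PRE]} ∪ {`LZZRoadInput` [typed
  tree-currency reading of LZZ18 Duke 167 (2018) — PUB — + Collins 2020 Thm. 5 + YZZ13 §1.6 + the class number formula, the
  readings R-D/R-D′/(AV-p)/(L3′)/R-N1/R-N3/R-P/R-M to be scored by the referee]}; the day the typist proves `LZZRoadInput`
  from the Literature side, the second set is PUB-discharged and the reading is «literal on Thm D alone».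

References: [LiuZhangZhang2018] Thm. 3.8, Thm. 3.10, Prop. 4.12 (arXiv:1511.08172 pp. 18, 23); [KellerYin2024] Thm. D =
Thm. 5.1.3 (PRE); [Castella2018Exceptional] Thms. 2.10–2.11; [Hsieh2014] Thm. 1; [GreenbergVatsal2000] Thm. (1.3);
[CastellaEtAl2021] Thm. 5.3.1; [Miller2011LMS] Def. 1.1; RULINGS L11 / L43; c2v MEMO-1/2; cgshw MEMO-18.
-/

set_option autoImplicit false
set_option linter.dupNamespace false

noncomputable section

open scoped Classical MatrixGroups ModularForm

open CongruenceSubgroup WeierstrassCurve NumberField IsDedekindDomain Field PowerSeries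
  Literature.NumberTheory.EllipticCurves Literature.NumberTheory.EllipticCurves.GreenbergSelmer
  Literature.NumberTheory.EllipticCurves.ModularForms Literature.NumberTheory.QuadraticFields
  Literature.NumberTheory.EllipticCurves.Rank1Residual
  Literature.NumberTheory.EllipticCurves.Rank1Residual.Typed
  Literature.NumberTheory.EllipticCurves.GreenbergVatsal2000
  Literature.NumberTheory.EllipticCurves.Wuthrich2014
  Literature.NumberTheory.EllipticCurves.SteinWuthrich2013
  Literature.NumberTheory.EllipticCurves.Castella2018Exceptional
  Literature.NumberTheory.GaloisRepresentations Literature.NumberTheory.GaloisCohomology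
  Literature.NumberTheory.Automorphic
  Summit.BirchSwinnertonDyer.Rank1Residual.X11b.AcSelmer
  Summit.BirchSwinnertonDyer.Rank1Residual.X11b.Halves
  Summit.BirchSwinnertonDyer.Rank1Residual.X11b
  Summit.BirchSwinnertonDyer.Rank1Residual.X2
  Summit.BirchSwinnertonDyer.Rank1Residual

namespace Summit.BirchSwinnertonDyer.BirchSwinnertonDyer.Theorems.Reoriented

/-- **v9's `stub_c2` VERBATIM from the typed LZZ input.** `X2.bdpValueContinuousDisplayAt_of_lzzRoadInput` at `p = 3`
(the kernel rescale of `X2/CellCBDPValueLZZRoad.lean`), then `stub_c2_of_continuousDisplay_three`. CONDITIONAL on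
`X2.LZZRoadInput` (typed input; NOT in print in this currency); nothing booked.
[cite: LiuZhangZhang2018, Thm. 3.8 and Thm. 3.10 and Prop. 4.12 (arXiv:1511.08172 pp. 18, 23) (source of the input; nothing asserted)] -/
theorem stub_c2_of_lzzRoadInput (hL : X2.LZZRoadInput) :
    (∀ (W : WeierstrassCurve ℚ) [W.IsElliptic] [W.IsGloballyMinimal] (p : ℕ) [Fact p.Prime],
        p = 3 → CellC W p → ¬ W.HasSplitMultiplicativeReductionAtPrime p → NonsplitBDPValueOnTreeInt W p) ∧
      (∀ (W : WeierstrassCurve ℚ) [W.IsElliptic] [W.IsGloballyMinimal] (p : ℕ) [Fact p.Prime],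
        p = 3 → CellC W p → W.HasSplitMultiplicativeReductionAtPrime p → SplitBDPValueOnTreeInt W p) :=
  stub_c2_of_continuousDisplay_three fun W _ _ ↦ X2.bdpValueContinuousDisplayAt_of_lzzRoadInput hL W 3

/-- **Crux 4 `BSDpOnCellC` AT THE PRE TIER with the value atom from the typed LZZ input:** from the 16 published facts +
[cas-split] (`hPub`), `X2.LZZRoadInput` (`hL`), Keller–Yin Thm. D BY NAME (`hD`, PREPRINT, gapped) and crux 3 (`hMCB`).
= `bsdpOnCellC_of_continuousDisplay_three_of_thmD_OPEN` ∘ `X2.bdpValueContinuousDisplayAt_of_lzzRoadInput`. A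
`conditional-result`: credits nothing, books nothing.
[claim: KellerYin2024, status: under-review] [cite: KellerYin2024, Thm. D = Thm. 5.1.3 (arXiv:2402.12781v2 L306–L309)]
[cite: LiuZhangZhang2018, Thm. 3.8 and Thm. 3.10 and Prop. 4.12 (arXiv:1511.08172 pp. 18, 23) (source of the input; nothing asserted)]
[cite: Castella2018Exceptional, Thm. 2.10 and Thm. 2.11 (arXiv:1507.04260 pp. 13–14)]
[cite: Hsieh2014, Thm. 1 (arXiv:1112.1580 pp. 3–4)] [cite: CastellaEtAl2021, Thm. 5.3.1] [cite: Miller2011LMS, Def. 1.1] -/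
theorem bsdpOnCellC_of_lzzRoadInput_of_thmD_OPEN
    (hPub : (lambdaMu_multiplicative_of_gvPar ∧ thm16_charIdeal_dvd_multiplicative_of_reducible ∧
      thm61_splitMultiplicative ∧ thm61_nonsplitMultiplicative ∧
      (∀ (W : WeierstrassCurve ℚ) [W.IsElliptic] [W.IsGloballyMinimal] (p : ℕ) [Fact p.Prime],
        greenberg_stevens (W := W) (p := p)) ∧
      exists_isNewformOf ∧
      (∀ (K : Type) [Field K] [NumberField K], poitouTate_selmerStructure_duality K) ∧
      (∀ (K : Type) [Field K] [NumberField K], poitouTate_sha_tateDual K) ∧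
      hsieh2014_exists_anticyclotomicPAdicLFunction ∧
      (∀ (N : ℕ) [NeZero N] (W : WeierstrassCurve ℚ) (K : Type) [Field K] [NumberField K],
        gross_zagier N W K) ∧
      (∀ (N : ℕ) [NeZero N] (W : WeierstrassCurve ℚ) (K : Type) [Field K] [NumberField K],
        kolyvagin N W K) ∧
      rank_eq_analyticRank_of_analyticRank_le_one ∧ HoffsteinLuo1997_exists_twist_L_one_ne_zero ∧
      mazur_not_dvd_maninConstant_of_odd ∧ bsdRHS_eq_of_isIsogenous) ∧
      thm210_thm211_bdpDisplay_pNew)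
    (hL : X2.LZZRoadInput)
    (hD : KellerYin2024.thmD_imcMult_exists_isBDPLFunction_isTorsion_charIdeal_eq_OPEN)
    (hMCB : Summit.BirchSwinnertonDyer.BirchSwinnertonDyer.Theses.EisensteinPrimes.MazurMCOnCellB) :
    Summit.BirchSwinnertonDyer.BirchSwinnertonDyer.Theses.EisensteinPrimes.BSDpOnCellC :=
  bsdpOnCellC_of_continuousDisplay_three_of_thmD_OPEN hPub
    (fun W _ _ ↦ X2.bdpValueContinuousDisplayAt_of_lzzRoadInput hL W 3) hD hMCB

/-- **The ψ-EVEN DOOR at every odd `p` with the value atom from the typed LZZ input: `CellC ∩ {¬GVPar} ⇒ BSD(E,p)`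
from the 16 published facts + [cas-split] (`hPub`), `X2.LZZRoadInput` (`hL`) and Keller–Yin Thm. D BY NAME (`hD`) — NO
crux 3, NO value atom.** = `bsdpOnCellCNotGV_of_continuousDisplay_three_of_thmD_OPEN` ∘
`X2.bdpValueContinuousDisplayAt_of_lzzRoadInput`. Census reading (no label moves here): every ψ-even B11 entry (9 981 @3 +
409 @5/@7 class-wide) reads {Thm. D [PRE]} ∪ {`LZZRoadInput` [typed reading of LZZ18 (PUB) + Collins Thm. 5 + YZZ13 §1.6 +
CNF]} by this name; «literal on Thm D alone» the day the typist discharges `LZZRoadInput`. A `conditional-result`.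
[claim: KellerYin2024, status: under-review] [cite: KellerYin2024, Thm. D = Thm. 5.1.3 (arXiv:2402.12781v2 L306–L309)]
[cite: LiuZhangZhang2018, Thm. 3.8 and Thm. 3.10 and Prop. 4.12 (arXiv:1511.08172 pp. 18, 23) (source of the input; nothing asserted)]
[cite: GreenbergVatsal2000, Thm. (1.3) and §2 p. 28] [cite: Hsieh2014, Thm. 1 (arXiv:1112.1580 pp. 3–4)]
[cite: CastellaEtAl2021, Thm. 5.3.1] [cite: Miller2011LMS, Def. 1.1] -/
theorem bsdpOnCellCNotGV_of_lzzRoadInput_of_thmD_OPEN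
    (hPub : (lambdaMu_multiplicative_of_gvPar ∧ thm16_charIdeal_dvd_multiplicative_of_reducible ∧
      thm61_splitMultiplicative ∧ thm61_nonsplitMultiplicative ∧
      (∀ (W : WeierstrassCurve ℚ) [W.IsElliptic] [W.IsGloballyMinimal] (p : ℕ) [Fact p.Prime],
        greenberg_stevens (W := W) (p := p)) ∧
      exists_isNewformOf ∧
      (∀ (K : Type) [Field K] [NumberField K], poitouTate_selmerStructure_duality K) ∧
      (∀ (K : Type) [Field K] [NumberField K], poitouTate_sha_tateDual K) ∧
      hsieh2014_exists_anticyclotomicPAdicLFunction ∧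
      (∀ (N : ℕ) [NeZero N] (W : WeierstrassCurve ℚ) (K : Type) [Field K] [NumberField K],
        gross_zagier N W K) ∧
      (∀ (N : ℕ) [NeZero N] (W : WeierstrassCurve ℚ) (K : Type) [Field K] [NumberField K],
        kolyvagin N W K) ∧
      rank_eq_analyticRank_of_analyticRank_le_one ∧ HoffsteinLuo1997_exists_twist_L_one_ne_zero ∧
      mazur_not_dvd_maninConstant_of_odd ∧ bsdRHS_eq_of_isIsogenous) ∧
      thm210_thm211_bdpDisplay_pNew)
    (hL : X2.LZZRoadInput)
    (hD : KellerYin2024.thmD_imcMult_exists_isBDPLFunction_isTorsion_charIdeal_eq_OPEN) :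
    ∀ (W : WeierstrassCurve ℚ) [W.IsElliptic] [W.IsGloballyMinimal] (p : ℕ) [Fact p.Prime],
      CellC W p → ¬ GVPar W p → BSDp W p :=
  bsdpOnCellCNotGV_of_continuousDisplay_three_of_thmD_OPEN hPub
    (fun W _ _ ↦ X2.bdpValueContinuousDisplayAt_of_lzzRoadInput hL W 3) hD

end Summit.BirchSwinnertonDyer.BirchSwinnertonDyer.Theorems.Reoriented

end
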